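import Summits.BirchSwinnertonDyer.Rank1Residual.GaloisImage.KuriharaTowerPackaging
import HarnessLib

/-!
# The `3`-adic TOWER PACKAGING with ONE SHARED GENERATOR `η` — the tower family that the repaired
# PORT′ (`KatoKuriharaPortThreeAtWith`, shared `η`) consumes
# (cell `b2b-bsdres`, team n1011; lead R5-110 (n3)(β); planner r1 GEN 47 (R-ii); typed by seat p18 GEN 10, filed unchanged by p18 GEN 11 on the lead's word R5-112 (a) / R5-113 (a))

HONEST FRAMING (run/shared/lean/b2b/bsd-rank1-residual/, verbatim in every file): the goal of the
cell is to DELETE the COMBINATION-SHAPED residual classes of the Birch–Swinnerton-Dyer formula for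
ALL analytic-rank `≤ 1` elliptic curves over `ℚ` — "full BSD formula for every rank `≤ 1` curve in
class `C`" assembled STRICTLY from published theorems — so that the rank-`≤ 1` remainder becomes
exactly the CONSTRUCTION-SHAPED classes, which are TYPED (missing-input `Prop`s), NOT attempted.
This is not "finishing BSD". Team n1011 (N10/N11, the additive block `X4 ∧ p = 3`): research
route; no claim beyond the stated classes; the label X4 and the mark of RESIDUAL-MAP §I N11 are
UNCHANGED by this file; nothing is booked.  TOOL theorems only (no definition, no named fact).
CONDITIONAL on the two [S24] named facts `hS24`, `hS24₂` exactly as the originals.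

## What and why

`TowerPackage.exists_towerFamily` (`KuriharaTowerPackaging.lean`) types its generators PER DEPTH
(`η : ℕ → …`, `(D′ k′).HasCanonicalComparison (3^{k′+1}) (η k′)`), because each depth's datum was
∃-packaged separately.  The repaired PORT′ `KatoKuriharaPortThreeAtWith W t v₃ η`
(`KatoKuriharaPortThreeWith.lean`; planner r1 GEN 47 (R-ii) after n1011-p11's anomaly on the
universal-closure PORT) relates only data canonical for ONE `η`; so the one-binder re-key of the record
corollaries `KuriharaRecordCorollaryThree[Deep]` needs the tower family with a SHARED generator.  This
file supplies it, changing nothing else: a global choice `η` with `⟨η_𝔮⟩ = (ℤ/N𝔮)ˣ` at every prime is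
an INPUT (`exists_eta_forall_zpowers_eq_top` provides one), and every depth's canonical `τ k′`-datum is
built for THAT `η` by p04's η-input constructor
`FSComp.exists_kolyvaginDatum_hasCanonicalComparison_frobeniusClassPrimes`; [S24] (1)+(2), Rubin's
local shape, the class-avoids-`S` clause and the nesting are the originals' proofs verbatim.

* `exists_eta_forall_zpowers_eq_top` — a global generator choice (each `(ℤ/N𝔮)ˣ` is cyclic).
* `exists_pinnedPackage_at_with` — ONE depth, pinned, for the given `η`.
* `exists_towerFamily_with` — ALL depths, the same `η` everywhere.

References: [Sakamoto2024] §2, Thm. 4.4 (1)(2) (p. 926); [Rubin2011] Prop. 1.9.5 (1), Def. 2.1.3;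
[MazurRubin2004] Def. 1.2.2, Lemma 1.2.3; cells/n1011/PLAN.md R5-110; cells/n1011/ROUTE-1.md §59.
-/

noncomputable section

open scoped Classical NumberField ContRepresentation
open Function Field NumberField IsDedekindDomain WeierstrassCurve
  Literature.NumberTheory.EllipticCurves
  Literature.NumberTheory.GaloisRepresentations
  Literature.NumberTheory.GaloisRepresentations.DiscreteGaloisModule Literature.NumberTheory.GaloisCohomology

namespace Summit.BirchSwinnertonDyer.Rank1Residual.GaloisImage.TowerPackage

variable (W : WeierstrassCurve ℚ) [W.IsElliptic]

/-- **A global choice of generators**: there is `η` with `⟨η_𝔮⟩ = (ℤ/N𝔮)ˣ` for EVERY prime `𝔮` of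
`ℚ` (`(ℤ/p)ˣ` is cyclic). [folklore] -/
theorem exists_eta_forall_zpowers_eq_top :
    ∃ η : (q : HeightOneSpectrum (𝓞 ℚ)) → (ZMod (Ideal.absNorm q.asIdeal))ˣ,
      ∀ q, Subgroup.zpowers (η q) = ⊤ := by
  have hgen : ∀ q : HeightOneSpectrum (𝓞 ℚ), ∃ η : (ZMod (Ideal.absNorm q.asIdeal))ˣ,
      Subgroup.zpowers η = ⊤ := fun q => by
    haveI : Fact (Ideal.absNorm q.asIdeal).Prime := ⟨FSComp.prime_absNorm_rat q⟩
    obtain ⟨g, hg⟩ := IsCyclic.exists_generator (α := (ZMod (Ideal.absNorm q.asIdeal))ˣ)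
    exact ⟨g, (Subgroup.eq_top_iff' _).mpr hg⟩
  choose η hη using hgen
  exact ⟨η, hη⟩

/-- **Everything at ONE depth, pinned, ∃-packaged, for a GIVEN generator `η`** (the shared-generator twin of
`exists_pinnedPackage_at`, PORT′ repair R5-110 (n3)(β) / r1 GEN 47 (R-ii): the canonical comparison maps are built
for the INPUT `η` by p04's η-input constructor `FSComp.exists_kolyvaginDatum_hasCanonicalComparison_frobeniusClassPrimes`): under the `3`-adic tower, for
`S ⊇ ∞ ∪ {3} ∪ {bad}`, there are an admissible `τ` at level `3^{k+1}` (from the tower,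
`exists_rootsOfUnityFixer_cokerSubOne_equiv_of_towerSurj`), THE canonical
`τ`-datum `D` at depth `k` on Sakamoto's class (p04's T-HCC constructor), and one Kolyvagin system
`g ∈ KS₁` of order `3^{k+1}` that ℕ-generates `KS₁` and satisfies Thm. 4.4 (2) in ORDER form at
every level for every full-level Poitou–Tate family.  CONDITIONAL on `hS24`, `hS24₂`.
[cite: Sakamoto2024, §2 (H.2) and Thm. 4.4 (1)(2) (p. 926)] -/
theorem exists_pinnedPackage_at_with
    (hS24 : Sakamoto2024.kolyvaginSystems_freeRankOne_zmod_three_pow)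
    (hS24₂ : Sakamoto2024.kolyvaginSystems_idealOfBasis_eq_fittingIdeal_zmod_three_pow) (k : ℕ)
    [hfin : Finite (geomTorsion W (((3 : ℕ) : ℤ) ^ k * ((3 : ℕ) : ℤ)))]
    (htower : ∀ n : ℕ, W.HasSurjectiveModNGaloisRep (3 ^ n : ℕ))
    (inv : LocalInvariants ℚ 3) (hperf : inv.IsPerfect) (hsum : inv.SumLocalTermEqZero)
    (hcompl : inv.SelmerComplement)
    (hEP : ∀ v : HeightOneSpectrum (𝓞 ℚ), localEulerPoincareCharacteristic (v.adicCompletion ℚ))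
    (S : Finset (Place ℚ)) (hS : ∀ w : InfinitePlace ℚ, (Sum.inl w : Place ℚ) ∈ S)
    (h3S : ∀ v : HeightOneSpectrum (𝓞 ℚ), ((3 : ℕ) : 𝓞 ℚ) ∈ v.asIdeal → (Sum.inr v : Place ℚ) ∈ S)
    (hbadS : ∀ v : HeightOneSpectrum (𝓞 ℚ), ¬ W.HasGoodReductionAt v → (Sum.inr v : Place ℚ) ∈ S)
    (η : (q : HeightOneSpectrum (𝓞 ℚ)) → (ZMod (Ideal.absNorm q.asIdeal))ˣ)
    (hη : ∀ q : HeightOneSpectrum (𝓞 ℚ), Subgroup.zpowers (η q) = ⊤) :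
    ∃ (τ : absoluteGaloisGroup ℚ)
      (D : KolyvaginDatum (W.torsionGaloisModule (((3 : ℕ) : ℤ) ^ k * ((3 : ℕ) : ℤ))))
      (g : Finset (HeightOneSpectrum (𝓞 ℚ)) →
        galoisCohomology (W.torsionGaloisModule (((3 : ℕ) : ℤ) ^ k * ((3 : ℕ) : ℤ))) 1),
      τ ∈ rootsOfUnityFixer ℚ (3 ^ (k + 1)) ∧
      Nonempty (cokerSubOne (W.torsionGaloisModule (((3 : ℕ) : ℤ) ^ k * ((3 : ℕ) : ℤ))) τ ≃+
        ZMod (3 ^ (k + 1))) ∧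
      D.primes = frobeniusClassPrimes (W.torsionGaloisModule (((3 : ℕ) : ℤ) ^ k * ((3 : ℕ) : ℤ)))
        {v | (Sum.inr v : Place ℚ) ∈ S} τ (3 ^ (k + 1)) ∧
      D.transverse = cyclotomicTransverse (W.torsionGaloisModule (((3 : ℕ) : ℤ) ^ k * ((3 : ℕ) : ℤ))) ∧
      D.HasCanonicalComparison (3 ^ (k + 1)) η ∧
      g ∈ D.kolyvaginSystems (propagatedSelmerStructure W 3 k) ∧
      addOrderOf g = 3 ^ (k + 1) ∧
      (∀ κ' ∈ D.kolyvaginSystems (propagatedSelmerStructure W 3 k), ∃ a : ℕ, κ' = a • g) ∧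
      ∀ (inv' : LocalInvariants ℚ (3 ^ (k + 1))), inv'.IsPerfect → inv'.SumLocalTermEqZero →
        inv'.SelmerComplement →
        ∀ d, D.IsLevel d →
          (Nat.card (inv'.dualSelmerStructure _
              (D.atLevel (propagatedSelmerStructure W 3 k) d)).selmerGroup ∣ 3 ^ (k + 1) →
            addOrderOf (g d) * Nat.card (inv'.dualSelmerStructure _
              (D.atLevel (propagatedSelmerStructure W 3 k) d)).selmerGroup = 3 ^ (k + 1)) ∧
          (3 ^ (k + 1) ∣ Nat.card (inv'.dualSelmerStructure _
              (D.atLevel (propagatedSelmerStructure W 3 k) d)).selmerGroup → g d = 0) := by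
  haveI : Fact (Nat.Prime 3) := ⟨Nat.prime_three⟩
  haveI : Finite (geomTorsion W ((3 : ℕ) : ℤ)) :=
    finite_torsionPoints_holds W (AlgebraicClosure ℚ) (by norm_num)
  obtain ⟨τ, hτμ, hτq⟩ := exists_rootsOfUnityFixer_cokerSubOne_equiv_of_towerSurj W 3 k htower
  obtain ⟨D, hP, hT, hD⟩ :=
    FSComp.exists_kolyvaginDatum_hasCanonicalComparison_frobeniusClassPrimes
      (W.torsionGaloisModule (((3 : ℕ) : ℤ) ^ k * ((3 : ℕ) : ℤ))) (3 ^ (k + 1))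
      {v | (Sum.inr v : Place ℚ) ∈ S} hτμ hτq
      (cyclotomicTransverse (W.torsionGaloisModule (((3 : ℕ) : ℤ) ^ k * ((3 : ℕ) : ℤ)))) η
      (fun q _ => hη q)
  obtain ⟨κ, -, hgo, hgen, hR22⟩ := exists_generator_kolyvaginSystems_of_towerSurj W hS24 hS24₂ k
    htower τ hτμ hτq inv hperf hsum hcompl hEP S hS h3S hbadS D η hP hT hD
  exact ⟨τ, D, κ.1, hτμ, hτq, hP, hT, hD, κ.2, hgo, hgen, hR22⟩


/-- **The `3`-adic TOWER FAMILY on class A1 with ONE SHARED generator `η` for ALL depths** (the twin of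
`exists_towerFamily` that PORT′ = `KatoKuriharaPortThreeAtWith W t v₃ η` consumes: every `D′ k′` is canonical for the
SAME input `η`; R5-110 (n3)(β) / r1 GEN 47 (R-ii)).  Under the tower, for `S ⊇ ∞ ∪ {3} ∪ {bad}`, there
are families indexed by the depth `k′` — an admissible `τ k′` at `3^{k′+1}`, THE
canonical `τ k′`-datum `D′ k′` for `E[3^{k′+1}]` on Sakamoto's pinned class, a generator `g′ k′` of
`KS₁` — carrying every per-depth property the END theorem consumes: `hP′`/`hDT′`/`hD′` (shape),
`hg′`/`hgo′`/`hgen′` ([S24] (1)), `hR22′` ([S24] (2), ORDER form, for every full-level PT family),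
Rubin's local shape `hUT′` (p270588), `hPS′` (the class avoids `S`), and the NESTING
`(D′ k′).primes ⊆ (D′ 0).primes` (class independence under surj(3), this seat's
`FrobShape.frobeniusClassPrimes_pow_mul_subset_of_le`) — so that `D := D′ 0` is a shallow datum at
depth `0` with `hPP′`.  CONDITIONAL on `hS24`, `hS24₂`.
[cite: Sakamoto2024, §2 and Thm. 4.4 (1)(2) (p. 926)] [cite: Rubin2011, Prop. 1.9.5 (1) and Def. 2.1.3] -/
theorem exists_towerFamily_with
    (hS24 : Sakamoto2024.kolyvaginSystems_freeRankOne_zmod_three_pow)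
    (hS24₂ : Sakamoto2024.kolyvaginSystems_idealOfBasis_eq_fittingIdeal_zmod_three_pow)
    (htower : ∀ n : ℕ, W.HasSurjectiveModNGaloisRep (3 ^ n : ℕ))
    (inv : LocalInvariants ℚ 3) (hperf : inv.IsPerfect) (hsum : inv.SumLocalTermEqZero)
    (hcompl : inv.SelmerComplement)
    (hEP : ∀ v : HeightOneSpectrum (𝓞 ℚ), localEulerPoincareCharacteristic (v.adicCompletion ℚ))
    (S : Finset (Place ℚ)) (hS : ∀ w : InfinitePlace ℚ, (Sum.inl w : Place ℚ) ∈ S)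
    (h3S : ∀ v : HeightOneSpectrum (𝓞 ℚ), ((3 : ℕ) : 𝓞 ℚ) ∈ v.asIdeal → (Sum.inr v : Place ℚ) ∈ S)
    (hbadS : ∀ v : HeightOneSpectrum (𝓞 ℚ), ¬ W.HasGoodReductionAt v → (Sum.inr v : Place ℚ) ∈ S)
    (η : (q : HeightOneSpectrum (𝓞 ℚ)) → (ZMod (Ideal.absNorm q.asIdeal))ˣ)
    (hη : ∀ q : HeightOneSpectrum (𝓞 ℚ), Subgroup.zpowers (η q) = ⊤) :
    ∃ (τ : ℕ → absoluteGaloisGroup ℚ)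
      (D' : ∀ k' : ℕ, KolyvaginDatum (W.torsionGaloisModule (((3 : ℕ) : ℤ) ^ k' * ((3 : ℕ) : ℤ))))
      (g' : ∀ k' : ℕ, Finset (HeightOneSpectrum (𝓞 ℚ)) →
        galoisCohomology (W.torsionGaloisModule (((3 : ℕ) : ℤ) ^ k' * ((3 : ℕ) : ℤ))) 1),
      (∀ k', τ k' ∈ rootsOfUnityFixer ℚ (3 ^ (k' + 1))) ∧
      (∀ k', Nonempty (cokerSubOne (W.torsionGaloisModule (((3 : ℕ) : ℤ) ^ k' * ((3 : ℕ) : ℤ))) (τ k')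
        ≃+ ZMod (3 ^ (k' + 1)))) ∧
      (∀ k', (D' k').primes = frobeniusClassPrimes
        (W.torsionGaloisModule (((3 : ℕ) : ℤ) ^ k' * ((3 : ℕ) : ℤ))) {v | (Sum.inr v : Place ℚ) ∈ S}
        (τ k') (3 ^ (k' + 1))) ∧
      (∀ k', (D' k').transverse = cyclotomicTransverse _) ∧
      (∀ k', (D' k').HasCanonicalComparison (3 ^ (k' + 1)) η) ∧
      (∀ k', g' k' ∈ (D' k').kolyvaginSystems (propagatedSelmerStructure W 3 k')) ∧
      (∀ k', addOrderOf (g' k') = 3 ^ (k' + 1)) ∧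
      (∀ k', ∀ κ ∈ (D' k').kolyvaginSystems (propagatedSelmerStructure W 3 k'), ∃ a : ℕ, κ = a • g' k') ∧
      (∀ k' (inv' : LocalInvariants ℚ (3 ^ (k' + 1))), inv'.IsPerfect → inv'.SumLocalTermEqZero →
        inv'.SelmerComplement → ∀ d, (D' k').IsLevel d →
          haveI := finite_geomTorsion_pow_mul W 3 k'
          (Nat.card (inv'.dualSelmerStructure _
              ((D' k').atLevel (propagatedSelmerStructure W 3 k') d)).selmerGroup ∣ 3 ^ (k' + 1) →
            addOrderOf (g' k' d) * Nat.card (inv'.dualSelmerStructure _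
              ((D' k').atLevel (propagatedSelmerStructure W 3 k') d)).selmerGroup = 3 ^ (k' + 1)) ∧
          (3 ^ (k' + 1) ∣ Nat.card (inv'.dualSelmerStructure _
              ((D' k').atLevel (propagatedSelmerStructure W 3 k') d)).selmerGroup → g' k' d = 0)) ∧
      (∀ k', ∀ q ∈ (D' k').primes,
        Nat.card (unramifiedSubgroup (GaloisRep.toLocal q
          (W.torsionGaloisModule (((3 : ℕ) : ℤ) ^ k' * ((3 : ℕ) : ℤ)))) 1) =
          Nat.card ((D' k').transverse (Sum.inr q))) ∧
      (∀ k', ∀ q ∈ (D' k').primes, (Sum.inr q : Place ℚ) ∉ S) ∧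
      (∀ k', (D' k').primes ⊆ (D' 0).primes) := by
  haveI : Fact (Nat.Prime 3) := ⟨Nat.prime_three⟩
  choose τ D g hτμ hτq hP hT hD hg hgo hgen hR22 using fun k' =>
    exists_pinnedPackage_at_with W hS24 hS24₂ k' (hfin := finite_geomTorsion_pow_mul W 3 k') htower inv
      hperf hsum hcompl hEP S hS h3S hbadS η hη
  refine ⟨τ, D, g, hτμ, hτq, hP, hT, hD, hg, hgo, hgen, hR22, fun k' => ?_, fun k' q hq => ?_,
    fun k' => ?_⟩
  · -- Rubin's local shape at Sakamoto's primes (p270588)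
    haveI : NeZero (3 ^ (k' + 1)) := ⟨pow_ne_zero _ three_ne_zero⟩
    haveI := finite_geomTorsion_pow_mul W 3 k'
    exact natCard_unramifiedSubgroup_eq_natCard_transverse_rat_of_primes_eq
      (W.torsionGaloisModule (((3 : ℕ) : ℤ) ^ k' * ((3 : ℕ) : ℤ))) (hP k') (hT k') (hτq k') (hτμ k')
      (pow_succ_nsmul_geomTorsion_eq_zero W 3 k')
  · -- the class avoids `S`
    rw [hP k'] at hq
    exact hq.1
  · -- nesting against depth `0`: class independence under surj(3)
    rw [hP k', hP 0]
    have h3 : W.HasSurjectiveModNGaloisRep (((3 : ℕ) : ℤ) ^ 0 * ((3 : ℕ) : ℤ)) := by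
      simpa using htower 1
    exact FrobShape.frobeniusClassPrimes_pow_mul_subset_of_le W 3 (Nat.zero_le k') h3 (hτμ 0) (hτq 0)
      (hτμ k') (hτq k') _


end Summit.BirchSwinnertonDyer.Rank1Residual.GaloisImage.TowerPackage

end
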